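import Summits.CriticalPhenomena.Ising3DConformalLimit.Theses.PerfectScreening

/-!
# PerfectScreening — assembly glue (item stmt-CriticalPhenomena-1349)

The rev-3 chain of route `PerfectScreening` as one implication, pure logic:
SubH → NonSat → GreenAsymptotics → ScreeningUpgrade → GaussCoulomb → MoebLim →
`Ising3DConformalLimit`.

Proof: take the Möbius-covariant non-degenerate limit `(ρ, Δ, S)` from MoebLim; it remains to
show clause (iii) `HasNontrivialU4 S`. If it failed, GaussCoulomb gives `c > 0` with
`c / ‖x‖ ≤ G x` for `x ≠ 0`, while ScreeningUpgrade (fed GreenAsymptotics, SubH, NonSat) gives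
`‖x‖ * G x → 0` along the cofinite filter of `ℤ³`; since `ℤ³` is infinite, some `x ≠ 0` has
`‖x‖ * G x < c`, contradicting `c ≤ ‖x‖ * G x`.
-/

namespace Summit.CriticalPhenomena.Ising3DConformalLimit.Theorems

open Filter Literature.Probability.LatticeModels

/-- **Assembly glue of route PerfectScreening** (item stmt-CriticalPhenomena-1349): the
implication SubH → NonSat → GreenAsymptotics → ScreeningUpgrade → GaussCoulomb → MoebLim →
`Ising3DConformalLimit`, proved by pure logic — the MoebLim witness supplies clauses (i)–(ii) of
the conjunct, and clause (iii) `U₄ ≢ 0` holds because otherwise the Coulomb lower bound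
`c / ‖x‖ ≤ G` from GaussCoulomb is incompatible with perfect screening `‖x‖ G → 0` from
ScreeningUpgrade at any far enough `x ≠ 0`. [folklore] -/
theorem assembly_proof :
    Summit.CriticalPhenomena.Ising3DConformalLimit.Theses.PerfectScreening.Assembly := by
  unfold Summit.CriticalPhenomena.Ising3DConformalLimit.Theses.PerfectScreening.Assembly
  intro hSubH hNonSat hGreen hUpgrade hGauss hMoeb
  obtain ⟨ρ, Δ, S, hρ, hΔ, hlim, hnd, hM⟩ := hMoeb
  refine ⟨ρ, Δ, S, hρ, hΔ, hlim, hnd, hM, ?_⟩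
  -- clause (iii) by contradiction: suppose U₄ ≡ 0 on non-coincident configurations
  by_contra hU4
  -- a Gaussian Möbius limit forces a Coulomb lower bound on the lattice two-point function
  obtain ⟨c, hc, hcG⟩ := hGauss ρ Δ S hρ hlim hnd hM hU4
  -- SubH + NonSat + Green asymptotics give perfect screening ‖x‖·G(x) → 0
  have hT : Tendsto (fun x : Site 3 => ‖x‖ * criticalTwoPoint 3 x) cofinite (nhds 0) :=
    hUpgrade hGreen hSubH hNonSat
  have hev : ∀ᶠ x : Site 3 in cofinite, ‖x‖ * criticalTwoPoint 3 x < c :=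
    hT (Iio_mem_nhds hc)
  obtain ⟨x, hx, hx0⟩ := (hev.and (eventually_cofinite_ne (0 : Site 3))).exists
  have hpos : 0 < ‖x‖ := norm_pos_iff.mpr hx0
  have hle : c / ‖x‖ ≤ criticalTwoPoint 3 x := hcG x hx0
  rw [div_le_iff₀ hpos] at hle
  linarith [mul_comm ‖x‖ (criticalTwoPoint 3 x)]

end Summit.CriticalPhenomena.Ising3DConformalLimit.Theorems
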